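import Summits.Ventures.HSemireg.WedgeHankelRecurrenceGaussChebyshevSineMultipleAngle

/-!
# Venture HSemireg — **THE RATIONAL ROOTS OF THE VIETA–LUCAS POLYNOMIALS: `S_n` has exactly the rational roots `0` (iff `n` odd) and `±1` (iff `n ≡ 2 (mod 3)`), and `C_n` has the single rational
# root `0` iff `n` is odd and none otherwise** (Niven's theorem applied to the root multisets `2cos(kπ∕(n+1))`, `2cos((2k+1)π∕2n)` of N500), with the period-`6` value tables `S_n(±1)`, `C_n(±1)` over every ring

HONEST FRAMING. Part of the Lean index of the computation cell `pub-hsemireg` (seat p10 gen 49, Sunday typer «UNIFORM-IN-n»).  Polynomial algebra over a commutative ring (Mathlib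
`Polynomial.Chebyshev.S ∕ C ∕ U ∕ T`) and Mathlib's Niven theorem (`niven`) on top of the real root multisets of N500; no variety, no cohomology theory, no sheaf, no Ext group and no semiregularity
map is constructed here; nothing here says that HC / HC_CM / HC_AV holds; no Literature fact (unproved `Prop`) is declared or used.  Custodian versions as in `WedgeHankelSiegelIdeal` (1/3).
SOURCES (cited).  I. Niven, *Irrational Numbers* (Carus Monograph 11, 1956), Cor. 3.12 (the rational values of `cos` at rational multiples of `π` are `0, ±1∕2, ±1`; Mathlib `niven`); D. H. Lehmer,
*A note on trigonometric algebraic numbers*, Amer. Math. Monthly 40 (1933) 165–166 (`2cos(2πk∕n)` is an algebraic integer); D. A. Wolfram, *Factoring variants of Chebyshev polynomials with minimal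
polynomials of `cos(2π∕d)`*, arXiv:2106.14585 (factorisation of the Vieta–Lucas polynomials into the minimal polynomials `Ψ_d`, which contains the rational-root classification).
PROOF TYPED HERE.  (1) Over every commutative ring: `S_{n+3}(1) = −S_n(1)` and `C_{n+3}(1) = −C_n(1)` (two applications of the three-term recurrence at `X = 1`), whence the period-`6` tables
`S_{3m}(1) = S_{3m+1}(1) = (−1)^m`, `S_{3m+2}(1) = 0`, `C_{3m}(1) = 2(−1)^m`, `C_{3m+1}(1) = (−1)^m`, `C_{3m+2}(1) = −(−1)^m`; the parity rules `S_n(−x) = (−1)^n S_n(x)`, `C_n(−x) = (−1)^n C_n(x)`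
(two-step induction) and `S_n(0) = U_n(0)`, `C_n(0) = 2T_n(0)` (Mathlib `S_comp_two_mul_X`, `C_comp_two_mul_X`) give the values at `−1` and `0`.  (2) Over `ℝ`: a root of `S_n` is `2cos(rπ)` with
`r = (k+1)∕(n+1) ∈ (0, 1)` (N500 `chebyshevS_roots_real`), a root of `C_n` is `2cos(rπ)` with `r = (2k+1)∕(2n) ∈ (0, 1)`; if it is rational, Niven's theorem puts `cos(rπ)` in `{0, ±1∕2, ±1}` and
`0 < rπ < π` excludes `±1`.  (3) Over `ℚ`: the roots of `S_n`, `C_n` embed into the simple real roots (`Polynomial.map_roots_le`, `map_S ∕ map_C`, N500 `…_nodup`), so the rational root multisets are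
`Nodup` and are determined by membership (`Multiset.Nodup.ext`), which (1) decides.
DEDUP DISCLOSURE (`rg -n 'eval_one|eval_neg|IsRoot.*1|roots_rat|Rational' Summits/Ventures/HSemireg -g 'WedgeHankelRecurrenceGaussChebyshev*'`, `lean search niven`, 2026-09-04): Mathlib has
`niven`, `S_eval_two`, `S_eval_neg_two`, `U_eval_one`, `U_eval_neg`, `T_eval_neg`, `T ∕ U_eval_zero_of_odd` and, for `T_n` ONLY, `Polynomial.Chebyshev.irrational_of_isRoot_T_real` (a non-zero
real root of `T_n` is irrational — the `C_n` statement below could also be derived from it via `C_n(2X) = 2T_n(X)`; it is typed here from `niven` directly, uniformly with `S_n`), but no values of `S_n`,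
`C_n` at `±1`, no parity rule for `S`, `C` and no rational-root MULTISET statement; the tree has N516 `chebyshevS_eval_zero_two_mul` and `chebyshevC_eval_zero_zmod_two` (other rings ∕ points)
only; 0 hits for the 20 names below.

WHAT IS IN THE TREE.  N500 `chebyshevS_roots_real`, `chebyshevS_roots_real_nodup`, `chebyshevC_roots_real`, `chebyshevC_roots_real_nodup`, `chebyshevC_eq_prod_real`; §10xx `chebyshevS_natDegree_monic`;
Mathlib `niven`, `Polynomial.Chebyshev.S_add_two ∕ C_add_two ∕ S_two ∕ C_two`, `S_comp_two_mul_X`, `C_comp_two_mul_X`, `U_eval_zero_of_odd`, `T_eval_zero_of_odd`, `T_eval_two_mul_zero`,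
`map_S`, `map_C`, `Polynomial.map_roots_le`, `Multiset.Nodup.ext`, `Real.cos_lt_cos_of_nonneg_of_le_pi`.
THIS FILE (namespace `Summit.Ventures.HSemireg.Wedge.HankelOuter` continued; CHAINED on N518; 0 definitions):
* §1284 `chebyshevS_eval_one_add_three`, `chebyshevS_eval_one_three_mul ∕ _add_one ∕ _add_two`, **`chebyshevS_eval_one_eq`**, **`chebyshevS_isRoot_one_iff`** (`↔ n % 3 = 2`), `chebyshevS_eval_neg`
  (parity), **`chebyshevS_isRoot_neg_one_iff`**, `chebyshevS_eval_zero_eq_U_eval_zero`, **`chebyshevS_isRoot_zero_iff`** (`↔ Odd n`); `chebyshevC_eval_one_add_three`, **`chebyshevC_eval_one_eq`**,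
  **`chebyshevC_eval_one_ne_zero`**, `chebyshevC_eval_neg`, **`chebyshevC_eval_neg_one_ne_zero`**, `chebyshevC_eval_zero_eq_two_mul_T_eval_zero`, **`chebyshevC_isRoot_zero_iff`** (`↔ Odd n`, `char 0`);
  `two_mul_cos_rat_mul_pi_of_rational` (Niven on `(0, π)`), **`chebyshevS_roots_real_rational`**, **`chebyshevC_roots_real_rational`** (a rational real root is `−1`, `0` or `1`),
  **`chebyshevS_roots_rat`** (`(S_n over ℚ).roots = [n odd]·{0} + [n ≡ 2 (3)]·{1, −1}`), **`chebyshevC_roots_rat`** (`(C_n over ℚ).roots = [n odd]·{0}`).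
CAVEATS.  The `IsRoot` criteria need a nontrivial ring (and characteristic `0` for `C_n`, where `C_{3m}(1) = ±2`); the closed forms hold in every commutative ring.  Nothing Ext-side.  New names only.
-/

open Module Polynomial
open scoped Matrix Polynomial

namespace Summit.Ventures.HSemireg.Wedge.HankelOuter

/-! ## §1284. Rational roots of `S_n` and `C_n` (Niven) -/

/-! ### Values of `S_n` at `1`, `−1`, `0` over a commutative ring -/

/-- `S_{n+3}(1) = −S_n(1)` (the three-term recurrence twice at `X = 1`). [this file, §1284] -/
theorem chebyshevS_eval_one_add_three {R : Type*} [CommRing R] (n : ℤ) :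
    (Polynomial.Chebyshev.S R (n + 3)).eval 1 = -(Polynomial.Chebyshev.S R n).eval 1 := by
  have h3 : Polynomial.Chebyshev.S R (n + 3) = X * Polynomial.Chebyshev.S R (n + 2) - Polynomial.Chebyshev.S R (n + 1) := by
    rw [show n + 3 = n + 1 + 2 by ring, Polynomial.Chebyshev.S_add_two, show n + 1 + 1 = n + 2 by ring]
  rw [h3, Polynomial.Chebyshev.S_add_two, eval_sub, eval_mul, eval_X, one_mul, eval_sub, eval_mul, eval_X, one_mul]
  ring

/-- `S_{3m}(1) = (−1)^m`. [this file, §1284] -/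
theorem chebyshevS_eval_one_three_mul {R : Type*} [CommRing R] (m : ℕ) : (Polynomial.Chebyshev.S R ((3 * m : ℕ) : ℤ)).eval 1 = (-1) ^ m := by
  induction m with
  | zero => simp
  | succ m ih =>
    rw [show (((3 * (m + 1) : ℕ) : ℤ)) = ((3 * m : ℕ) : ℤ) + 3 by push_cast; ring, chebyshevS_eval_one_add_three, ih, pow_succ]
    ring

/-- `S_{3m+1}(1) = (−1)^m`. [this file, §1284] -/
theorem chebyshevS_eval_one_three_mul_add_one {R : Type*} [CommRing R] (m : ℕ) : (Polynomial.Chebyshev.S R ((3 * m + 1 : ℕ) : ℤ)).eval 1 = (-1) ^ m := by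
  induction m with
  | zero => simp
  | succ m ih =>
    rw [show (((3 * (m + 1) + 1 : ℕ) : ℤ)) = ((3 * m + 1 : ℕ) : ℤ) + 3 by push_cast; ring, chebyshevS_eval_one_add_three, ih, pow_succ]
    ring

/-- `S_{3m+2}(1) = 0`. [this file, §1284] -/
theorem chebyshevS_eval_one_three_mul_add_two {R : Type*} [CommRing R] (m : ℕ) : (Polynomial.Chebyshev.S R ((3 * m + 2 : ℕ) : ℤ)).eval 1 = 0 := by
  induction m with
  | zero => simp [Polynomial.Chebyshev.S_two]
  | succ m ih =>
    rw [show (((3 * (m + 1) + 2 : ℕ) : ℤ)) = ((3 * m + 2 : ℕ) : ℤ) + 3 by push_cast; ring, chebyshevS_eval_one_add_three, ih, neg_zero]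

/-- **`S_n(1) = 0` if `n ≡ 2 (mod 3)` and `S_n(1) = (−1)^{⌊n∕3⌋}` otherwise** (period `6`: `1, 1, 0, −1, −1, 0`). [this file, §1284] -/
theorem chebyshevS_eval_one_eq {R : Type*} [CommRing R] (n : ℕ) :
    (Polynomial.Chebyshev.S R (n : ℤ)).eval 1 = if n % 3 = 2 then 0 else (-1) ^ (n / 3) := by
  obtain ⟨m, h | h | h⟩ : ∃ m, n = 3 * m ∨ n = 3 * m + 1 ∨ n = 3 * m + 2 := ⟨n / 3, by omega⟩
  · subst h; rw [chebyshevS_eval_one_three_mul, if_neg (by omega), show 3 * m / 3 = m by omega]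
  · subst h; rw [chebyshevS_eval_one_three_mul_add_one, if_neg (by omega), show (3 * m + 1) / 3 = m by omega]
  · subst h; rw [chebyshevS_eval_one_three_mul_add_two, if_pos (by omega)]

/-- **`1` is a root of `S_n` iff `n ≡ 2 (mod 3)`** (nontrivial ring). [this file, §1284] -/
theorem chebyshevS_isRoot_one_iff {R : Type*} [CommRing R] [Nontrivial R] (n : ℕ) : (Polynomial.Chebyshev.S R (n : ℤ)).IsRoot 1 ↔ n % 3 = 2 := by
  rw [IsRoot.def, chebyshevS_eval_one_eq]
  by_cases h : n % 3 = 2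
  · simp [h]
  · simp only [h, iff_false, if_false]
    exact ((isUnit_one (M := R)).neg.pow (n / 3)).ne_zero

/-- Parity: `S_n(−x) = (−1)^n S_n(x)`. [this file, §1284] -/
theorem chebyshevS_eval_neg {R : Type*} [CommRing R] (n : ℕ) (x : R) :
    (Polynomial.Chebyshev.S R (n : ℤ)).eval (-x) = (-1) ^ n * (Polynomial.Chebyshev.S R (n : ℤ)).eval x := by
  induction n using Nat.twoStepInduction with
  | zero => simp
  | one => simp
  | more n ih0 ih1 =>
    rw [show ((n + 2 : ℕ) : ℤ) = (n : ℤ) + 2 by push_cast; ring, Polynomial.Chebyshev.S_add_two, show (n : ℤ) + 1 = ((n + 1 : ℕ) : ℤ) by push_cast; ring,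
      eval_sub, eval_mul, eval_X, ih0, ih1, eval_sub, eval_mul, eval_X, pow_succ, pow_succ]
    ring

/-- **`−1` is a root of `S_n` iff `n ≡ 2 (mod 3)`** (nontrivial ring). [this file, §1284] -/
theorem chebyshevS_isRoot_neg_one_iff {R : Type*} [CommRing R] [Nontrivial R] (n : ℕ) : (Polynomial.Chebyshev.S R (n : ℤ)).IsRoot (-1) ↔ n % 3 = 2 := by
  rw [IsRoot.def, chebyshevS_eval_neg, ((isUnit_one (M := R)).neg.pow n).mul_right_eq_zero, ← IsRoot.def, chebyshevS_isRoot_one_iff]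

/-- `S_n(0) = U_n(0)` (`S_n(2X) = U_n(X)` at `X = 0`). [this file, §1284] -/
theorem chebyshevS_eval_zero_eq_U_eval_zero {R : Type*} [CommRing R] (n : ℤ) : (Polynomial.Chebyshev.S R n).eval 0 = (Polynomial.Chebyshev.U R n).eval 0 := by
  have h := congrArg (Polynomial.eval (0 : R)) (Polynomial.Chebyshev.S_comp_two_mul_X R n)
  rw [eval_comp, eval_mul, eval_ofNat, eval_X, mul_zero] at h
  exact h

/-- **`0` is a root of `S_n` iff `n` is odd** (nontrivial ring). [this file, §1284] -/
theorem chebyshevS_isRoot_zero_iff {R : Type*} [CommRing R] [Nontrivial R] (n : ℕ) : (Polynomial.Chebyshev.S R (n : ℤ)).IsRoot 0 ↔ Odd n := by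
  rw [IsRoot.def]
  rcases Nat.even_or_odd n with h | h
  · obtain ⟨m, rfl⟩ := h
    rw [show ((m + m : ℕ) : ℤ) = 2 * (m : ℤ) by push_cast; ring, chebyshevS_eval_zero_two_mul]
    simp only [((isUnit_one (M := R)).neg.pow m).ne_zero, false_iff, Nat.not_odd_iff_even]
    exact ⟨m, rfl⟩
  · rw [chebyshevS_eval_zero_eq_U_eval_zero, Polynomial.Chebyshev.U_eval_zero_of_odd R ((Int.odd_coe_nat n).mpr h)]
    simp [h]

/-! ### Values of `C_n` at `1`, `−1`, `0` over a commutative ring -/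

/-- `C_{n+3}(1) = −C_n(1)`. [this file, §1284] -/
theorem chebyshevC_eval_one_add_three {R : Type*} [CommRing R] (n : ℤ) :
    (Polynomial.Chebyshev.C R (n + 3)).eval 1 = -(Polynomial.Chebyshev.C R n).eval 1 := by
  have h3 : Polynomial.Chebyshev.C R (n + 3) = X * Polynomial.Chebyshev.C R (n + 2) - Polynomial.Chebyshev.C R (n + 1) := by
    rw [show n + 3 = n + 1 + 2 by ring, Polynomial.Chebyshev.C_add_two, show n + 1 + 1 = n + 2 by ring]
  rw [h3, Polynomial.Chebyshev.C_add_two, eval_sub, eval_mul, eval_X, one_mul, eval_sub, eval_mul, eval_X, one_mul]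
  ring

/-- **`C_{3m}(1) = 2(−1)^m`, `C_{3m+1}(1) = (−1)^m`, `C_{3m+2}(1) = −(−1)^m`** (period `6`: `2, 1, −1, −2, −1, 1`). [this file, §1284] -/
theorem chebyshevC_eval_one_eq {R : Type*} [CommRing R] (m : ℕ) :
    (Polynomial.Chebyshev.C R ((3 * m : ℕ) : ℤ)).eval 1 = 2 * (-1) ^ m ∧ (Polynomial.Chebyshev.C R ((3 * m + 1 : ℕ) : ℤ)).eval 1 = (-1) ^ m ∧
      (Polynomial.Chebyshev.C R ((3 * m + 2 : ℕ) : ℤ)).eval 1 = -(-1) ^ m := by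
  induction m with
  | zero => simp [Polynomial.Chebyshev.C_two]; norm_num
  | succ m ih =>
    obtain ⟨h0, h1, h2⟩ := ih
    refine ⟨?_, ?_, ?_⟩
    · rw [show (((3 * (m + 1) : ℕ) : ℤ)) = ((3 * m : ℕ) : ℤ) + 3 by push_cast; ring, chebyshevC_eval_one_add_three, h0, pow_succ]; ring
    · rw [show (((3 * (m + 1) + 1 : ℕ) : ℤ)) = ((3 * m + 1 : ℕ) : ℤ) + 3 by push_cast; ring, chebyshevC_eval_one_add_three, h1, pow_succ]; ring
    · rw [show (((3 * (m + 1) + 2 : ℕ) : ℤ)) = ((3 * m + 2 : ℕ) : ℤ) + 3 by push_cast; ring, chebyshevC_eval_one_add_three, h2, pow_succ]; ring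

/-- **`C_n(1) ≠ 0` in characteristic `0`** (`1` is never a root of `C_n`). [this file, §1284] -/
theorem chebyshevC_eval_one_ne_zero {R : Type*} [CommRing R] [CharZero R] (n : ℕ) : (Polynomial.Chebyshev.C R (n : ℤ)).eval 1 ≠ 0 := by
  haveI : Nontrivial R := nontrivial_of_ne 1 0 one_ne_zero
  obtain ⟨m, h | h | h⟩ : ∃ m, n = 3 * m ∨ n = 3 * m + 1 ∨ n = 3 * m + 2 := ⟨n / 3, by omega⟩
  all_goals have hu : IsUnit ((-1 : R) ^ m) := (isUnit_one (M := R)).neg.pow m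
  · subst h; rw [(chebyshevC_eval_one_eq m).1]
    exact fun h0 => two_ne_zero (hu.mul_left_eq_zero.mp h0)
  · subst h; rw [(chebyshevC_eval_one_eq m).2.1]
    exact hu.ne_zero
  · subst h; rw [(chebyshevC_eval_one_eq m).2.2]
    exact neg_ne_zero.mpr hu.ne_zero

/-- Parity: `C_n(−x) = (−1)^n C_n(x)`. [this file, §1284] -/
theorem chebyshevC_eval_neg {R : Type*} [CommRing R] (n : ℕ) (x : R) :
    (Polynomial.Chebyshev.C R (n : ℤ)).eval (-x) = (-1) ^ n * (Polynomial.Chebyshev.C R (n : ℤ)).eval x := by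
  induction n using Nat.twoStepInduction with
  | zero => simp
  | one => simp
  | more n ih0 ih1 =>
    rw [show ((n + 2 : ℕ) : ℤ) = (n : ℤ) + 2 by push_cast; ring, Polynomial.Chebyshev.C_add_two, show (n : ℤ) + 1 = ((n + 1 : ℕ) : ℤ) by push_cast; ring,
      eval_sub, eval_mul, eval_X, ih0, ih1, eval_sub, eval_mul, eval_X, pow_succ, pow_succ]
    ring

/-- **`C_n(−1) ≠ 0` in characteristic `0`** (`−1` is never a root of `C_n`). [this file, §1284] -/
theorem chebyshevC_eval_neg_one_ne_zero {R : Type*} [CommRing R] [CharZero R] (n : ℕ) : (Polynomial.Chebyshev.C R (n : ℤ)).eval (-1) ≠ 0 := by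
  rw [chebyshevC_eval_neg, Ne, ((isUnit_one (M := R)).neg.pow n).mul_right_eq_zero]
  exact chebyshevC_eval_one_ne_zero n

/-- `C_n(0) = 2T_n(0)` (`C_n(2X) = 2T_n(X)` at `X = 0`). [this file, §1284] -/
theorem chebyshevC_eval_zero_eq_two_mul_T_eval_zero {R : Type*} [CommRing R] (n : ℤ) :
    (Polynomial.Chebyshev.C R n).eval 0 = 2 * (Polynomial.Chebyshev.T R n).eval 0 := by
  have h := congrArg (Polynomial.eval (0 : R)) (Polynomial.Chebyshev.C_comp_two_mul_X R n)
  rw [eval_comp, eval_mul, eval_ofNat, eval_X, mul_zero, eval_mul, eval_ofNat] at h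
  exact h

/-- **`0` is a root of `C_n` iff `n` is odd** (characteristic `0`; `C_{2m}(0) = 2(−1)^m`). [this file, §1284] -/
theorem chebyshevC_isRoot_zero_iff {R : Type*} [CommRing R] [CharZero R] (n : ℕ) : (Polynomial.Chebyshev.C R (n : ℤ)).IsRoot 0 ↔ Odd n := by
  rw [IsRoot.def, chebyshevC_eval_zero_eq_two_mul_T_eval_zero]
  rcases Nat.even_or_odd n with h | h
  · obtain ⟨m, rfl⟩ := h
    rw [show ((m + m : ℕ) : ℤ) = 2 * (m : ℤ) by push_cast; ring, Polynomial.Chebyshev.T_eval_two_mul_zero, Int.cast_negOnePow_natCast]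
    have hne : (2 : R) * (-1) ^ m ≠ 0 := fun h0 => two_ne_zero (((isUnit_one (M := R)).neg.pow m).mul_left_eq_zero.mp h0)
    simp only [hne, false_iff, Nat.not_odd_iff_even]
    exact ⟨m, rfl⟩
  · rw [Polynomial.Chebyshev.T_eval_zero_of_odd R ((Int.odd_coe_nat n).mpr h), mul_zero]
    simp [h]

/-! ### Niven: a rational real root is `−1`, `0` or `1` -/

/-- Niven on `(0, π)`: if `0 < r < 1` and `2cos(rπ)` is rational then `2cos(rπ) ∈ {−1, 0, 1}`. [Niven 1956, Cor. 3.12 (Mathlib `niven`); this file, §1284] -/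
theorem two_mul_cos_rat_mul_pi_of_rational {r : ℚ} (h0 : 0 < r) (h1 : r < 1) (hq : ∃ q : ℚ, 2 * Real.cos (r * Real.pi) = q) :
    2 * Real.cos (r * Real.pi) = -1 ∨ 2 * Real.cos (r * Real.pi) = 0 ∨ 2 * Real.cos (r * Real.pi) = 1 := by
  obtain ⟨q, hq⟩ := hq
  have hmem := niven (θ := r * Real.pi) ⟨r, rfl⟩ ⟨q / 2, by push_cast; linarith⟩
  have hr0 : (0 : ℝ) < r := by exact_mod_cast h0
  have hr1 : (r : ℝ) < 1 := by exact_mod_cast h1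
  have hlt : Real.cos (r * Real.pi) < 1 := by
    have h := Real.cos_lt_cos_of_nonneg_of_le_pi le_rfl (by nlinarith [Real.pi_pos]) (by positivity : (0 : ℝ) < r * Real.pi)
    rwa [Real.cos_zero] at h
  have hgt : -1 < Real.cos (r * Real.pi) := by
    have h := Real.cos_lt_cos_of_nonneg_of_le_pi (by positivity : (0 : ℝ) ≤ r * Real.pi) le_rfl (by nlinarith [Real.pi_pos] : (r : ℝ) * Real.pi < Real.pi)
    rwa [Real.cos_pi] at h
  simp only [Set.mem_insert_iff, Set.mem_singleton_iff] at hmem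
  rcases hmem with h | h | h | h | h
  · exact absurd h hgt.ne'
  · exact Or.inl (by rw [h]; norm_num)
  · exact Or.inr (Or.inl (by rw [h]; norm_num))
  · exact Or.inr (Or.inr (by rw [h]; norm_num))
  · exact absurd h hlt.ne

/-- **A rational real root of `S_n` is `−1`, `0` or `1`.** [Niven 1956, Cor. 3.12; Lehmer 1933; this file, §1284] -/
theorem chebyshevS_roots_real_rational {n : ℕ} {x : ℝ} (hx : x ∈ (Polynomial.Chebyshev.S ℝ (n : ℤ)).roots) (hq : ∃ q : ℚ, x = q) : x = -1 ∨ x = 0 ∨ x = 1 := by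
  rw [chebyshevS_roots_real, Multiset.mem_map] at hx
  obtain ⟨k, hk, rfl⟩ := hx
  rw [Multiset.mem_range] at hk
  have hr : (k + 1 : ℝ) * Real.pi / (n + 1) = ((((k + 1 : ℕ) : ℚ) / ((n + 1 : ℕ) : ℚ) : ℚ) : ℝ) * Real.pi := by
    rw [Rat.cast_div, Rat.cast_natCast, Rat.cast_natCast]; push_cast; ring
  rw [hr] at hq ⊢
  refine two_mul_cos_rat_mul_pi_of_rational (by positivity) ?_ hq
  rw [div_lt_one (by positivity)]
  exact_mod_cast (by omega : k + 1 < n + 1)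

/-- **A rational real root of `C_n` is `−1`, `0` or `1`.** [Niven 1956, Cor. 3.12; Lehmer 1933; this file, §1284] -/
theorem chebyshevC_roots_real_rational {n : ℕ} {x : ℝ} (hx : x ∈ (Polynomial.Chebyshev.C ℝ (n : ℤ)).roots) (hq : ∃ q : ℚ, x = q) : x = -1 ∨ x = 0 ∨ x = 1 := by
  rw [chebyshevC_roots_real, Multiset.mem_map] at hx
  obtain ⟨k, hk, rfl⟩ := hx
  rw [Multiset.mem_range] at hk
  have hn : (0 : ℚ) < ((2 * n : ℕ) : ℚ) := by exact_mod_cast (by omega : 0 < 2 * n)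
  have hr : (2 * k + 1 : ℝ) * Real.pi / (2 * n) = ((((2 * k + 1 : ℕ) : ℚ) / ((2 * n : ℕ) : ℚ) : ℚ) : ℝ) * Real.pi := by
    rw [Rat.cast_div, Rat.cast_natCast, Rat.cast_natCast]; push_cast; ring
  rw [hr] at hq ⊢
  refine two_mul_cos_rat_mul_pi_of_rational (div_pos (by positivity) hn) ?_ hq
  rw [div_lt_one hn]
  exact_mod_cast (by omega : 2 * k + 1 < 2 * n)

/-! ### The rational root multisets -/

/-- **The rational roots of `S_n`: `(S_n over ℚ).roots = [n odd]·{0} + [n ≡ 2 (mod 3)]·{1, −1}`** (all simple). [Niven 1956, Cor. 3.12; Wolfram 2021; this file, §1284] -/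
theorem chebyshevS_roots_rat (n : ℕ) :
    (Polynomial.Chebyshev.S ℚ (n : ℤ)).roots = (if Odd n then {0} else 0) + (if n % 3 = 2 then {1, -1} else 0) := by
  have hS0 : Polynomial.Chebyshev.S ℚ (n : ℤ) ≠ 0 := (chebyshevS_natDegree_monic (R := ℚ) n).2.ne_zero
  have hmap : (Polynomial.Chebyshev.S ℚ (n : ℤ)).map (algebraMap ℚ ℝ) = Polynomial.Chebyshev.S ℝ (n : ℤ) := Polynomial.Chebyshev.map_S _ _
  have hle : (Polynomial.Chebyshev.S ℚ (n : ℤ)).roots.map (algebraMap ℚ ℝ) ≤ (Polynomial.Chebyshev.S ℝ (n : ℤ)).roots := by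
    rw [← hmap]
    exact Polynomial.map_roots_le (by rw [hmap]; exact (chebyshevS_natDegree_monic (R := ℝ) n).2.ne_zero)
  have hnd : (Polynomial.Chebyshev.S ℚ (n : ℤ)).roots.Nodup := by
    refine Multiset.Nodup.of_map (algebraMap ℚ ℝ) (Multiset.nodup_of_le hle ?_)
    rw [chebyshevS_roots_real]
    exact chebyshevS_roots_real_nodup n
  have hnd' : ((if Odd n then {0} else 0) + (if n % 3 = 2 then {1, -1} else 0) : Multiset ℚ).Nodup := by
    split_ifs <;> decide
  refine (Multiset.Nodup.ext hnd hnd').mpr fun q => ?_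
  rw [mem_roots hS0, Multiset.mem_add]
  constructor
  · intro hq
    have hxR : ((q : ℝ)) ∈ (Polynomial.Chebyshev.S ℝ (n : ℤ)).roots :=
      Multiset.mem_of_le hle (Multiset.mem_map.mpr ⟨q, (mem_roots hS0).mpr hq, rfl⟩)
    rcases chebyshevS_roots_real_rational hxR ⟨q, rfl⟩ with h | h | h
    · have hq1 : q = -1 := by exact_mod_cast h
      subst hq1
      exact Or.inr (by rw [if_pos ((chebyshevS_isRoot_neg_one_iff (R := ℚ) n).mp hq)]; simp)
    · have hq0 : q = 0 := by exact_mod_cast h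
      subst hq0
      exact Or.inl (by rw [if_pos ((chebyshevS_isRoot_zero_iff (R := ℚ) n).mp hq)]; simp)
    · have hq1 : q = 1 := by exact_mod_cast h
      subst hq1
      exact Or.inr (by rw [if_pos ((chebyshevS_isRoot_one_iff (R := ℚ) n).mp hq)]; simp)
  · rintro (hq | hq)
    · by_cases hodd : Odd n
      · rw [if_pos hodd, Multiset.mem_singleton] at hq
        subst hq
        exact (chebyshevS_isRoot_zero_iff (R := ℚ) n).mpr hodd
      · simp [hodd] at hq
    · by_cases h3 : n % 3 = 2
      · rw [if_pos h3, Multiset.insert_eq_cons, Multiset.mem_cons, Multiset.mem_singleton] at hq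
        rcases hq with rfl | rfl
        · exact (chebyshevS_isRoot_one_iff (R := ℚ) n).mpr h3
        · exact (chebyshevS_isRoot_neg_one_iff (R := ℚ) n).mpr h3
      · simp [h3] at hq

/-- **The rational roots of `C_n`: `(C_n over ℚ).roots = [n odd]·{0}`** (`±1` are never roots, `0` is a simple root iff `n` is odd). [Niven 1956, Cor. 3.12; Wolfram 2021; this file, §1284] -/
theorem chebyshevC_roots_rat (n : ℕ) : (Polynomial.Chebyshev.C ℚ (n : ℤ)).roots = if Odd n then {0} else 0 := by
  rcases Nat.eq_zero_or_pos n with rfl | hn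
  · rw [Nat.cast_zero, Polynomial.Chebyshev.C_zero, ← Polynomial.C_ofNat, roots_C]; simp
  have hmap : (Polynomial.Chebyshev.C ℚ (n : ℤ)).map (algebraMap ℚ ℝ) = Polynomial.Chebyshev.C ℝ (n : ℤ) := Polynomial.Chebyshev.map_C _ _
  have hR0 : Polynomial.Chebyshev.C ℝ (n : ℤ) ≠ 0 := by
    rw [chebyshevC_eq_prod_real hn.ne']
    exact (monic_prod_of_monic _ _ fun k _ => monic_X_sub_C _).ne_zero
  have hC0 : Polynomial.Chebyshev.C ℚ (n : ℤ) ≠ 0 := fun h => hR0 (by rw [← hmap, h, Polynomial.map_zero])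
  have hle : (Polynomial.Chebyshev.C ℚ (n : ℤ)).roots.map (algebraMap ℚ ℝ) ≤ (Polynomial.Chebyshev.C ℝ (n : ℤ)).roots := by
    rw [← hmap]
    exact Polynomial.map_roots_le (by rw [hmap]; exact hR0)
  have hnd : (Polynomial.Chebyshev.C ℚ (n : ℤ)).roots.Nodup := by
    refine Multiset.Nodup.of_map (algebraMap ℚ ℝ) (Multiset.nodup_of_le hle ?_)
    rw [chebyshevC_roots_real]
    exact chebyshevC_roots_real_nodup n
  have hnd' : ((if Odd n then {0} else 0) : Multiset ℚ).Nodup := by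
    split_ifs <;> decide
  refine (Multiset.Nodup.ext hnd hnd').mpr fun q => ?_
  rw [mem_roots hC0]
  constructor
  · intro hq
    have hxR : ((q : ℝ)) ∈ (Polynomial.Chebyshev.C ℝ (n : ℤ)).roots :=
      Multiset.mem_of_le hle (Multiset.mem_map.mpr ⟨q, (mem_roots hC0).mpr hq, rfl⟩)
    rcases chebyshevC_roots_real_rational hxR ⟨q, rfl⟩ with h | h | h
    · have hq1 : q = -1 := by exact_mod_cast h
      subst hq1
      exact absurd hq (chebyshevC_eval_neg_one_ne_zero (R := ℚ) n)
    · have hq0 : q = 0 := by exact_mod_cast h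
      subst hq0
      rw [if_pos ((chebyshevC_isRoot_zero_iff (R := ℚ) n).mp hq)]
      simp
    · have hq1 : q = 1 := by exact_mod_cast h
      subst hq1
      exact absurd hq (chebyshevC_eval_one_ne_zero (R := ℚ) n)
  · intro hq
    by_cases hodd : Odd n
    · rw [if_pos hodd, Multiset.mem_singleton] at hq
      subst hq
      exact (chebyshevC_isRoot_zero_iff (R := ℚ) n).mpr hodd
    · simp [hodd] at hq

end Summit.Ventures.HSemireg.Wedge.HankelOuter
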